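import Summits.CriticalPhenomena.PercolationContinuityZ3.Theorems.Transplant.PlanarSkeletonConcDefs
import Summits.CriticalPhenomena.PercolationContinuityZ3.Theorems.Transplant.PlanarSkeletonPrisms
import Literature.Probability.Percolation.SitePaths
import HarnessLib

/-!
# L4.3 of the general node (`HOME/SHEAR-SCOPE.md` §3.9): the CYLINDER BALLS `cylBall t ℓ R` (balls of the INDUCED cylinder graph) —
# finiteness, monotonicity, one-step growth, INTERNAL CONNECTIVITY (the wired-source obligation (C1)), FRAME IMAGES OF CYLINDER BALLS
# ARE CYLINDER BALLS (exactly), and invariance under the lifted point group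

builds on p205010 (kernel theorem, internal audit signed; external expert review pending) — nothing in this file uses p205010.
Lane `prim-bschramm`, seat `prim-bschramm-p3` (gen 4; lead 17:59:48Z: L4.3 to p3); helper file (`--supports stmt-CriticalPhenomena-4575 --as helper`).
Design of record V83/V85: the fat prisms / wired sources / inner link sets of the generic (D) re-typing are `PlanarSkeletonConc.cylBall`
(p5-g4 §p5 item 2, (C1) of §p3 3.0 item 4): unlike `graphBall t R ∩ cyl t ℓ` they are connected INSIDE themselves, and — like prisms —
they are carried to each other EXACTLY by the frames (no shear) and fixed by the lifted point group at a base vertex.  The comparison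
radius ψ′ between the two kinds of balls is the refuter's append to `PlanarSkeletonConcDefs` (not duplicated here).
* §1 `cylBall_finite`, `cylBallFin`, `mem_cylBallFin`, `cylBall_subset_cyl`, `self_mem_cylBall`, `cylBall_subset_prismAt`,
  `exists_walk_induce_map` / `exists_walk_induce_mono` (walks of `G.induce S` pushed along an adjacency-preserving map into `G.induce T`), `cylBall_mono` (in `ℓ` and `R`),
  `mem_cylBall_succ_of_adj`;
* §2 **`pathIn_cylBall`** — every point of `cylBall t ℓ R` is joined to `t` by a `G`-path INSIDE `cylBall t ℓ R` (`PathIn`), `pathIn_cylBall'`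
  (any two points);
* §3 **`image_cylBall_of_frame`** (`α t = c`, `φ ∘ α = φ + (φ c − φ t)` ⇒ `α '' cylBall t ℓ R = cylBall c ℓ R`), `exists_frame_image_cylBall`,
  **`image_cylBall_of_point`** (`α t = t`, `φ ∘ α − φ t = sp g (φ − φ t)`, `Λ_ℓ` `sp g`-invariant ⇒ `α '' cylBall t ℓ R = cylBall t ℓ R`).
[cite: KozmaNitzan2024, §4 p. 19 (the wired cube), Lemma 11 (p. 22), p. 20 ((22)–(23))] [cite: GrimmettPercolation1999, §1.6 (paths)]
-/

noncomputable section

namespace Summit.CriticalPhenomena.PercolationContinuityZ3.Theorems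

namespace Transplant

namespace Skel

open Literature.Probability.Percolation Literature.Probability.LatticeModels SimpleGraph
open Literature.Probability.Percolation.GM
open Literature.Barriers.CriticalPhenomena (graphBall graphBall_finite mem_graphBall_self graphBall_mono mem_graphBall_map)

variable {V : Type} {G : SimpleGraph V} [G.LocallyFinite] (Φ : PlanarSkeletonConc G)

/-! ## §1 Finiteness, monotonicity, one-step growth -/

/-- Cylinder balls are finite. [folklore] -/
theorem cylBall_finite (t : V) (ℓ R : ℕ) : (Φ.cylBall t ℓ R).Finite :=
  (graphBall_finite G t R).subset fun _ hv => (Φ.cylBall_subset_prism t ℓ R hv).1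

/-- The cylinder ball as a `Finset`. [folklore] -/
def cylBallFin (t : V) (ℓ R : ℕ) : Finset V := (cylBall_finite Φ t ℓ R).toFinset

/-- Membership in `cylBallFin`. [folklore] -/
@[simp] theorem mem_cylBallFin {t : V} {ℓ R : ℕ} {v : V} : v ∈ cylBallFin Φ t ℓ R ↔ v ∈ Φ.cylBall t ℓ R := by
  rw [cylBallFin, Set.Finite.mem_toFinset]

/-- Cylinder balls lie in their cylinder. [folklore] -/
theorem cylBall_subset_cyl (t : V) (ℓ R : ℕ) : Φ.cylBall t ℓ R ⊆ Φ.toPlanarSkeleton.cyl t ℓ := by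
  rintro _ ⟨y, _, rfl⟩; exact y.2

/-- The centre lies in its cylinder balls. [folklore] -/
theorem self_mem_cylBall (t : V) (ℓ R : ℕ) : t ∈ Φ.cylBall t ℓ R :=
  ⟨⟨t, Φ.toPlanarSkeleton.mem_cyl_self t ℓ⟩, mem_graphBall_self _ _ R, rfl⟩

/-- Cylinder balls lie in the prisms of p3's dictionary (`prismAt t R Λ_ℓ`). [folklore] -/
theorem cylBall_subset_prismAt (t : V) (ℓ R : ℕ) : Φ.cylBall t ℓ R ⊆ Φ.toPlanarSkeleton.prismAt t R ↑(box 2 ℓ) := by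
  rw [← PlanarSkeleton.prism_eq_prismAt]; exact Φ.cylBall_subset_prism t ℓ R

omit [G.LocallyFinite] in
/-- **Walks of an induced graph pushed along an adjacency-preserving map**: if `f` preserves adjacency and maps `S` into `T`, a walk of
`G.induce S` gives a walk of `G.induce T` of the same length between the images. [folklore] -/
theorem exists_walk_induce_map (f : V → V) (hf : ∀ u v, G.Adj u v → G.Adj (f u) (f v)) {S T : Set V} (hST : Set.MapsTo f S T) :
    ∀ {x y : S} (w : (G.induce S).Walk x y), ∃ w' : (G.induce T).Walk ⟨f x, hST x.2⟩ ⟨f y, hST y.2⟩, w'.length = w.length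
  | _, _, .nil => ⟨.nil, rfl⟩
  | x, _, .cons (v := v) h w => by
    have hG : G.Adj (f x) (f v) := hf _ _ (SimpleGraph.induce_adj.1 h)
    obtain ⟨w', hw'⟩ := exists_walk_induce_map f hf hST w
    exact ⟨.cons (SimpleGraph.induce_adj.2 hG) w', by simp [hw']⟩

omit [G.LocallyFinite] in
/-- A walk of the graph induced on `S` is a walk of the graph induced on any `T ⊇ S`, of the same length. [folklore] -/
theorem exists_walk_induce_mono {S T : Set V} (hST : S ⊆ T) :
    ∀ {x y : S} (w : (G.induce S).Walk x y), ∃ w' : (G.induce T).Walk ⟨x, hST x.2⟩ ⟨y, hST y.2⟩, w'.length = w.length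
  | _, _, .nil => ⟨.nil, rfl⟩
  | x, _, .cons (v := v) h w => by
    have hG : G.Adj (x : V) (v : V) := SimpleGraph.induce_adj.1 h
    obtain ⟨w', hw'⟩ := exists_walk_induce_mono hST w
    exact ⟨.cons (SimpleGraph.induce_adj.2 hG) w', by simp [hw']⟩

/-- Cylinder balls grow with the half-width and the radius. [folklore] -/
theorem cylBall_mono (t : V) {ℓ ℓ' : ℕ} (hℓ : ℓ ≤ ℓ') {R R' : ℕ} (hR : R ≤ R') : Φ.cylBall t ℓ R ⊆ Φ.cylBall t ℓ' R' := by
  rintro _ ⟨y, ⟨w, hw⟩, rfl⟩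
  have hsub : Φ.toPlanarSkeleton.cyl t ℓ ⊆ Φ.toPlanarSkeleton.cyl t ℓ' := fun v hv => by
    rw [PlanarSkeleton.mem_cyl] at hv ⊢; exact box_mono 2 hℓ hv
  obtain ⟨w', hw'⟩ := exists_walk_induce_mono (G := G) hsub w
  exact ⟨⟨y, hsub y.2⟩, ⟨w', by rw [hw']; exact hw.trans hR⟩, rfl⟩

/-- A `G`-neighbour, inside the larger cylinder, of a point of `cylBall t ℓ R` lies in `cylBall t ℓ' (R + 1)` (`ℓ ≤ ℓ'`). [folklore] -/
theorem mem_cylBall_succ_of_adj (t : V) {ℓ ℓ' : ℕ} (hℓ : ℓ ≤ ℓ') {R : ℕ} {w v : V} (hw : w ∈ Φ.cylBall t ℓ R) (hadj : G.Adj w v)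
    (hv : v ∈ Φ.toPlanarSkeleton.cyl t ℓ') : v ∈ Φ.cylBall t ℓ' (R + 1) := by
  obtain ⟨y, ⟨wk, hwk⟩, rfl⟩ := hw
  have hsub : Φ.toPlanarSkeleton.cyl t ℓ ⊆ Φ.toPlanarSkeleton.cyl t ℓ' := fun u hu => by
    rw [PlanarSkeleton.mem_cyl] at hu ⊢; exact box_mono 2 hℓ hu
  obtain ⟨w', hw'⟩ := exists_walk_induce_mono (G := G) hsub wk
  have hadj' : (G.induce (Φ.toPlanarSkeleton.cyl t ℓ')).Adj ⟨(y : V), hsub y.2⟩ ⟨v, hv⟩ := SimpleGraph.induce_adj.2 hadj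
  refine ⟨⟨v, hv⟩, ⟨w'.append (SimpleGraph.Walk.cons hadj' SimpleGraph.Walk.nil), ?_⟩, rfl⟩
  rw [SimpleGraph.Walk.length_append, hw', SimpleGraph.Walk.length_cons, SimpleGraph.Walk.length_nil]
  omega

/-! ## §2 Internal connectivity (the wired-source obligation (C1)) -/

omit [G.LocallyFinite] in
/-- Walks of the induced cylinder graph of total length `≤ R` from `t` run inside `cylBall t ℓ R` and give `G`-paths inside it. [folklore] -/
theorem pathIn_cylBall_aux {S : Set V} (t₀ : S) (R : ℕ) :
    ∀ {u y : S} (w : (G.induce S).Walk u y) (q : (G.induce S).Walk t₀ u), q.length + w.length ≤ R →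
      PathIn G (Subtype.val '' graphBall (G.induce S) t₀ R) u y
  | u, _, .nil, q, h => PathIn.refl ⟨u, ⟨q, by simpa using h⟩, rfl⟩
  | u, _, .cons (v := v) hadj w, q, h => by
    have hlen : (q.append (.cons hadj .nil)).length + w.length ≤ R := by
      rw [SimpleGraph.Walk.length_append, SimpleGraph.Walk.length_cons, SimpleGraph.Walk.length_nil]
      rw [SimpleGraph.Walk.length_cons] at h; omega
    have ih := pathIn_cylBall_aux t₀ R w (q.append (.cons hadj .nil)) hlen
    have hu : (u : V) ∈ Subtype.val '' graphBall (G.induce S) t₀ R :=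
      ⟨u, ⟨q, by rw [SimpleGraph.Walk.length_cons] at h; omega⟩, rfl⟩
    exact (PathIn.of_adj hu ih.left_mem (SimpleGraph.induce_adj.1 hadj)).trans ih

/-- **Cylinder balls are internally connected from their centre**: every `y ∈ cylBall t ℓ R` is joined to `t` by a path of `G` all of whose
vertices lie in `cylBall t ℓ R` (the hypothesis `hconn` of `KNLevels.linkIn_subset_biUnion_openConnIn_of_wired` for wired sources).
[cite: KozmaNitzan2024, §4 p. 19 (the wired cube)] -/
theorem pathIn_cylBall {t : V} {ℓ R : ℕ} {y : V} (hy : y ∈ Φ.cylBall t ℓ R) : PathIn G (Φ.cylBall t ℓ R) t y := by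
  obtain ⟨y', ⟨w, hw⟩, rfl⟩ := hy
  exact pathIn_cylBall_aux (G := G) ⟨t, Φ.toPlanarSkeleton.mem_cyl_self t ℓ⟩ R w .nil (by simpa using hw)

/-- Any two points of a cylinder ball are joined inside it (through the centre). [folklore] -/
theorem pathIn_cylBall' {t : V} {ℓ R : ℕ} {x y : V} (hx : x ∈ Φ.cylBall t ℓ R) (hy : y ∈ Φ.cylBall t ℓ R) :
    PathIn G (Φ.cylBall t ℓ R) x y :=
  (pathIn_cylBall Φ hx).symm.trans (pathIn_cylBall Φ hy)

/-! ## §3 Frame images and point-group images of cylinder balls -/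

/-- A frame carries the cylinder at `t` into the cylinder at `c`. [folklore] -/
theorem mapsTo_cyl_of_frame {α : G ≃g G} {t c : V} (hφ : ∀ w, Φ.φ (α w) = Φ.φ w + (Φ.φ c - Φ.φ t)) (ℓ : ℕ) :
    Set.MapsTo α (Φ.toPlanarSkeleton.cyl t ℓ) (Φ.toPlanarSkeleton.cyl c ℓ) := by
  intro w hw
  rw [PlanarSkeleton.mem_cyl] at hw ⊢
  rwa [hφ w, show Φ.φ w + (Φ.φ c - Φ.φ t) - Φ.φ c = Φ.φ w - Φ.φ t by abel]

/-- One inclusion of the frame image. [folklore] -/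
theorem image_cylBall_subset_of_frame {α : G ≃g G} {t c : V} (hαt : α t = c) (hφ : ∀ w, Φ.φ (α w) = Φ.φ w + (Φ.φ c - Φ.φ t))
    (ℓ R : ℕ) : α '' Φ.cylBall t ℓ R ⊆ Φ.cylBall c ℓ R := by
  rintro _ ⟨_, ⟨y, ⟨w, hw⟩, rfl⟩, rfl⟩
  have hmap := mapsTo_cyl_of_frame Φ hφ ℓ
  obtain ⟨w', hw'⟩ := exists_walk_induce_map (G := G) α (fun _ _ h => α.map_adj_iff.2 h) hmap w
  have ht : (⟨α t, hmap (Φ.toPlanarSkeleton.mem_cyl_self t ℓ)⟩ : Φ.toPlanarSkeleton.cyl c ℓ) =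
      ⟨c, Φ.toPlanarSkeleton.mem_cyl_self c ℓ⟩ := Subtype.ext hαt
  refine ⟨⟨α y, hmap y.2⟩, ⟨w'.copy ht rfl, ?_⟩, rfl⟩
  rw [SimpleGraph.Walk.length_copy, hw']; exact hw

/-- The inverse of a frame is a frame in the opposite direction. [folklore] -/
theorem frame_symm {α : G ≃g G} {t c : V} (hαt : α t = c) (hφ : ∀ w, Φ.φ (α w) = Φ.φ w + (Φ.φ c - Φ.φ t)) :
    α.symm c = t ∧ ∀ w, Φ.φ (α.symm w) = Φ.φ w + (Φ.φ t - Φ.φ c) := by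
  refine ⟨by rw [← hαt, RelIso.symm_apply_apply], fun w => ?_⟩
  have h := hφ (α.symm w)
  rw [RelIso.apply_symm_apply] at h
  rw [h]; abel

/-- **Frame images of cylinder balls are cylinder balls — exactly** (no shear): `α t = c`, `φ ∘ α = φ + (φ c − φ t)` give
`α '' cylBall t ℓ R = cylBall c ℓ R`. [cite: KozmaNitzan2024, §4 p. 20 ((22)–(23): the lattice symmetries place the local objects)] -/
theorem image_cylBall_of_frame {α : G ≃g G} {t c : V} (hαt : α t = c) (hφ : ∀ w, Φ.φ (α w) = Φ.φ w + (Φ.φ c - Φ.φ t)) (ℓ R : ℕ) :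
    α '' Φ.cylBall t ℓ R = Φ.cylBall c ℓ R := by
  refine Set.Subset.antisymm (image_cylBall_subset_of_frame Φ hαt hφ ℓ R) fun v hv => ?_
  obtain ⟨hs, hφ'⟩ := frame_symm Φ hαt hφ
  have h := image_cylBall_subset_of_frame Φ hs hφ' ℓ R ⟨v, hv, rfl⟩
  exact ⟨α.symm v, h, RelIso.apply_symm_apply α v⟩

/-- **Every cylinder ball is the frame image of a cylinder ball at a base vertex** (field `frame`). [folklore] -/
theorem exists_frame_image_cylBall (c : V) (ℓ R : ℕ) :
    ∃ t ∈ Φ.types, ∃ α : G ≃g G, α t = c ∧ α '' Φ.cylBall t ℓ R = Φ.cylBall c ℓ R := by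
  obtain ⟨t, ht, α, hαt, hφ⟩ := Φ.frame c
  exact ⟨t, ht, α, hαt, image_cylBall_of_frame Φ hαt hφ ℓ R⟩

/-- **The lifted point group fixes the cylinder balls at a base vertex**: `α t = t`, `φ (α w) − φ t = sp g (φ w − φ t)` and `Λ_ℓ`
invariant under `sp g` give `α '' cylBall t ℓ R = cylBall t ℓ R`. [cite: KozmaNitzan2024, §4 p. 20 ((22)–(23))] -/
theorem image_cylBall_of_point {α : G ≃g G} {t : V} (hαt : α t = t) {g : HOct 2}
    (hφ : ∀ w, Φ.φ (α w) - Φ.φ t = sp g (Φ.φ w - Φ.φ t)) {ℓ : ℕ} (hbox : ∀ y : Site 2, sp g y ∈ box 2 ℓ ↔ y ∈ box 2 ℓ) (R : ℕ) :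
    α '' Φ.cylBall t ℓ R = Φ.cylBall t ℓ R := by
  -- both `α` and `α.symm` map the cylinder at `t` into itself and fix `t`
  have hmap : ∀ (β : G ≃g G), β t = t → (∀ w, Φ.φ (β w) - Φ.φ t ∈ box 2 ℓ ↔ Φ.φ w - Φ.φ t ∈ box 2 ℓ) →
      β '' Φ.cylBall t ℓ R ⊆ Φ.cylBall t ℓ R := by
    intro β hβt hβ
    rintro _ ⟨_, ⟨y, ⟨w, hw⟩, rfl⟩, rfl⟩
    have hm : Set.MapsTo β (Φ.toPlanarSkeleton.cyl t ℓ) (Φ.toPlanarSkeleton.cyl t ℓ) := fun w hw => by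
      rw [PlanarSkeleton.mem_cyl] at hw ⊢; exact (hβ w).2 hw
    obtain ⟨w', hw'⟩ := exists_walk_induce_map (G := G) β (fun _ _ h => β.map_adj_iff.2 h) hm w
    have ht : (⟨β t, hm (Φ.toPlanarSkeleton.mem_cyl_self t ℓ)⟩ : Φ.toPlanarSkeleton.cyl t ℓ) =
        ⟨t, Φ.toPlanarSkeleton.mem_cyl_self t ℓ⟩ := Subtype.ext hβt
    refine ⟨⟨β y, hm y.2⟩, ⟨w'.copy ht rfl, ?_⟩, rfl⟩
    rw [SimpleGraph.Walk.length_copy, hw']; exact hw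
  have hα : ∀ w, Φ.φ (α w) - Φ.φ t ∈ box 2 ℓ ↔ Φ.φ w - Φ.φ t ∈ box 2 ℓ := fun w => by rw [hφ w]; exact hbox _
  have hsymm_t : α.symm t = t := by rw [← hαt, RelIso.symm_apply_apply, hαt]
  have hαs : ∀ w, Φ.φ (α.symm w) - Φ.φ t ∈ box 2 ℓ ↔ Φ.φ w - Φ.φ t ∈ box 2 ℓ := fun w => by
    have h := hφ (α.symm w)
    rw [RelIso.apply_symm_apply] at h
    rw [← hbox (Φ.φ (α.symm w) - Φ.φ t), ← h]
  refine Set.Subset.antisymm (hmap α hαt hα) fun v hv => ?_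
  exact ⟨α.symm v, hmap α.symm hsymm_t hαs ⟨v, hv, rfl⟩, RelIso.apply_symm_apply α v⟩

end Skel

end Transplant

end Summit.CriticalPhenomena.PercolationContinuityZ3.Theorems

end
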